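import Summits.HodgeConjecture.CorCM.GaloisRankCertificates
import Summits.HodgeConjecture.CorCM.AbelianSixteenSimpleEightfoldsExist
import HarnessLib

/-!
# Kubota-rank certificates and NULL certificates for CM types of a Galois CM field, read on a multiplication TABLE

COR-CM (cell `pub-hodgecm2`), binder seat b04 (gen 17), count-neutral claim GALOIS16-COMPLETE (sequel of gen 16's
`GaloisRankCertificates`).  KERNEL ONLY: theorems; no definition, no named fact, no `sorry`.  `HC_CM` is neither
used nor claimed.

SETTING.  `K/ℚ` Galois CM, `G = Gal(K/ℚ)`, and a TABLE MODEL of `G`: a finite type `X`, an operation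
`mul : X → X → X` and a bijection `e : G ≃ X` with `e (g h) = mul (e g) (e h)` — no `Group` instance on `X`, so that
the groups of order `16` without a Mathlib incarnation (`SD₁₆`, `M₁₆`, the Pauli group `C₄ ∘ D₄`, `C₄ ⋊ C₄`,
`(C₄ × C₂) ⋊ C₂`) are decided on `ZMod`-coordinates, `e` coming from generators and relations of `Gal(K/ℚ)`.
Embeddings `σ_g = φ₀ ∘ g⁻¹`; a CM type `Φ` is read on `X` as `S = {y | σ_{e⁻¹ y} ∈ Φ}`; `Aut(ℂ)` acts by RIGHT
translations (`GaloisRankCertificates`).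

* §1–§3 `le_cmTypeRank_of_tableCert`, `isNondegenerate_of_tableCert`, `not_isPrimitive_of_tableStabiliser`,
  **`isNondegenerate_of_isPrimitive_of_tableCensus`**:
  gen 16's certificates and census soundness, transported to tables (translation hints stated inverse-free).
* §4 **`cmTypeRank_add_le_of_tableNull`** (NEW): `t` integer vectors orthogonal to EVERY right translate
  (`Σ_y [mul y h ∈ S] N_{y k} = 0`), independent by a diagonal minor, give `Rank(Φ) + t ≤ [K:ℚ]`;
  `not_isNondegenerate_of_tableNull` (`t = [K:ℚ]/2`) — certifies DEGENERATE types that are NOT of Weil type over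
  any subfield (gen 16's census: `SD₁₆`, `M₁₆`), where Yanai's criterion is silent.
* §5 `exists_isPrimitive_of_tableModel`; **`exists_simple_degenerate_of_tableNull`**: a CM set with trivial left
  stabiliser and a null certificate ⟹ a SIMPLE CM abelian variety of dimension `[K:ℚ]/2` with an exceptional Hodge
  class on some power.

## References

* [Dodson1987] B. Dodson, J. Algebra 111 (1987), §1.1 p. 50 (`Rank(Φ)`).
* [Kubota1965] T. Kubota, Trans. AMS 118 (1965), §2 p. 115, Lemma 2.
* [Shimura1998] G. Shimura, *Abelian Varieties with Complex Multiplication and Modular Functions*, §6.2 Thm. 3,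
  §8.1, §8.2 Prop. 26.
* [Gordon1999HodgeAVSurvey] B. B. Gordon, *A survey of the Hodge conjecture for abelian varieties*, Thm. 6.4, §9.4.
-/

noncomputable section

open CategoryTheory CategoryTheory.Limits NumberField
open scoped BigOperators

namespace Summit.HodgeConjecture.CorCM.GaloisTable

open Literature.NumberTheory.ComplexMultiplication
open Literature.AlgebraicGeometry.Motives (AbelianVariety CMType)
open Literature.AlgebraicGeometry.HodgeTheory
open Literature.AlgebraicGeometry.ComplexMultiplication (IsCMTypeRealisation isSimple_iff_isPrimitive)
open Literature.AlgebraicGeometry.Pohlmann1968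
open Literature.Barriers.HodgeConjecture (divisorClassesSpan)
open Summit.HodgeConjecture.CorCM.ThinKernel (not_isPrimitive_of_forall_mem_iff)
open Summit.HodgeConjecture.CorCM.AbelianSixteen (exists_simple_realisation_of_isPrimitive)

open scoped Classical

variable {K : Type} [Field K] [NumberField K] [IsCMField K]
variable {X : Type*} [Fintype X] [DecidableEq X]

/-! ## §0 Table models -/

omit [IsCMField K] [Fintype X] [DecidableEq X] in
/-- `e⁻¹ (mul p q) = e⁻¹ p · e⁻¹ q`. [folklore] -/
theorem symm_mul (mul : X → X → X) (e : (K ≃ₐ[ℚ] K) ≃ X) (hmul : ∀ a b, e (a * b) = mul (e a) (e b))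
    (p q : X) : e.symm (mul p q) = e.symm p * e.symm q := by
  apply e.injective
  rw [Equiv.apply_symm_apply, hmul, Equiv.apply_symm_apply, Equiv.apply_symm_apply]

omit [IsCMField K] [Fintype X] [DecidableEq X] in
/-- The table operation is associative (it is the group law of `Gal(K/ℚ)` transported). [folklore] -/
theorem mul_assoc_table (mul : X → X → X) (e : (K ≃ₐ[ℚ] K) ≃ X) (hmul : ∀ a b, e (a * b) = mul (e a) (e b))
    (p q s : X) : mul (mul p q) s = mul p (mul q s) := by
  apply e.symm.injective
  rw [symm_mul mul e hmul, symm_mul mul e hmul, symm_mul mul e hmul, symm_mul mul e hmul, mul_assoc]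

omit [IsCMField K] [DecidableEq X] in
/-- `[K:ℚ] = |X|` along `e` (`K/ℚ` Galois). [folklore] -/
theorem finrank_eq_card_table [IsGalois ℚ K] (e : (K ≃ₐ[ℚ] K) ≃ X) : Module.finrank ℚ K = Fintype.card X := by
  rw [← IsGalois.card_aut_eq_finrank, Nat.card_congr e, Nat.card_eq_fintype_card]

/-! ## §1 Certificates -/

omit [IsCMField K] [Fintype X] in
/-- **A certified nonsingular minor of the right-translate matrix on a table gives `r ≤ Rank(Φ)`**:
`Σ_j [mul x_j g_i ∈ S] M_{jk} = D δ_{ik}`, `D ≠ 0` ⟹ `r ≤ cmTypeRank Φ`. [cite: Dodson1987, §1.1 (p. 50)] -/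
theorem le_cmTypeRank_of_tableCert [IsGalois ℚ K] (mul : X → X → X) (e : (K ≃ₐ[ℚ] K) ≃ X)
    (hmul : ∀ a b, e (a * b) = mul (e a) (e b)) (Φ : CMType K) (φ₀ : K →+* ℂ) (S : Finset X)
    (hS : ∀ y : X, y ∈ S ↔ embOf φ₀ (e.symm y) ∈ Φ.1) {r : ℕ} (g x : Fin r → X) (M : Fin r → Fin r → ℤ) (D : ℤ)
    (hD : D ≠ 0)
    (hcert : ∀ i k : Fin r, (∑ j : Fin r, if mul (x j) (g i) ∈ S then M j k else 0) = if i = k then D else 0) :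
    r ≤ cmTypeRank Φ := by
  refine GaloisRank.le_cmTypeRank_of_galoisCert (G₀ := K ≃ₐ[ℚ] K) (MulEquiv.refl _) Φ φ₀
    (S.map e.symm.toEmbedding) (fun y => ?_) (fun i => e.symm (g i)) (fun j => e.symm (x j)) M D hD fun i k => ?_
  · rw [Finset.mem_map_equiv, Equiv.symm_symm, hS, Equiv.symm_apply_apply]; rfl
  · rw [← hcert i k]
    refine Finset.sum_congr rfl fun j _ => ?_
    have hiff : e.symm (x j) * e.symm (g i) ∈ S.map e.symm.toEmbedding ↔ mul (x j) (g i) ∈ S := by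
      rw [← symm_mul mul e hmul, Finset.mem_map_equiv, Equiv.symm_symm, Equiv.apply_symm_apply]
    by_cases h : mul (x j) (g i) ∈ S
    · rw [if_pos h, if_pos (hiff.2 h)]
    · rw [if_neg h, if_neg (fun h' => h (hiff.1 h'))]

omit [Fintype X] in
/-- **Certificate of full rank ⟹ nondegenerate** on a table. [cite: Dodson1987, §1.1 (p. 50)] -/
theorem isNondegenerate_of_tableCert [IsGalois ℚ K] (mul : X → X → X) (e : (K ≃ₐ[ℚ] K) ≃ X)
    (hmul : ∀ a b, e (a * b) = mul (e a) (e b)) (Φ : CMType K) (φ₀ : K →+* ℂ) (S : Finset X)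
    (hS : ∀ y : X, y ∈ S ↔ embOf φ₀ (e.symm y) ∈ Φ.1) {r : ℕ} (hr : r = Module.finrank ℚ K / 2 + 1)
    (g x : Fin r → X) (M : Fin r → Fin r → ℤ) (D : ℤ) (hD : D ≠ 0)
    (hcert : ∀ i k : Fin r, (∑ j : Fin r, if mul (x j) (g i) ∈ S then M j k else 0) = if i = k then D else 0) :
    IsNondegenerate Φ := by
  rw [isNondegenerate_iff]
  exact le_antisymm (cmTypeRank_le Φ) (hr ▸ le_cmTypeRank_of_tableCert mul e hmul Φ φ₀ S hS g x M D hD hcert)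

/-! ## §2 Left stabilisers -/

omit [IsCMField K] [Fintype X] [DecidableEq X] in
/-- **A left stabiliser `v ≠ e(1)` of `S` makes `Φ` imprimitive.** [cite: Shimura1998, §8.2 Prop. 26] -/
theorem not_isPrimitive_of_tableStabiliser [Normal ℚ K] (mul : X → X → X) (e : (K ≃ₐ[ℚ] K) ≃ X)
    (hmul : ∀ a b, e (a * b) = mul (e a) (e b)) (Φ : CMType K) (φ₀ : K →+* ℂ) (S : Finset X)
    (hS : ∀ y : X, y ∈ S ↔ embOf φ₀ (e.symm y) ∈ Φ.1) {v : X} (hv1 : v ≠ e 1)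
    (hv : ∀ w : X, w ∈ S ↔ mul v w ∈ S) : ¬ IsPrimitive (ℂ ≃+* ℂ) Φ.1 φ₀ := by
  refine not_isPrimitive_of_forall_mem_iff Φ φ₀ (v := e.symm v) (fun h => hv1 ?_) fun z => ?_
  · rw [← h, Equiv.apply_symm_apply]
  · have h := hv (e z)
    rw [hS, hS, symm_mul mul e hmul, Equiv.symm_apply_apply] at h
    exact h

/-! ## §3 Census soundness -/

/-- **Census over all CM sets of `(X, c₀)`, read back.**  Data: `c₀ = e(c)`, `o = e(1)`; a transversal
`R : Fin m → X` of the pairs `{y, mul c₀ y}` (`2m = [K:ℚ]`); CM sets encoded by `b < 2^m` as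
`S_b = {R l | bit_l b} ∪ {mul c₀ (R l) | ¬ bit_l b}`; representatives `reps : Fin q → Finset X`, each with a
CERTIFICATE; hints selecting for every `b` either a left stabiliser `stabOf b ≠ o` of `S_b` or a right translation
with `S_b = reps (repOf b) · δOf b` (stated inverse-free: `mul w (δOf b) ∈ S_b ↔ w ∈ reps (repOf b)`).  Then every
PRIMITIVE CM type of `K` is NONDEGENERATE.  `hcert` and `hcover` are decidable. [cite: Dodson1987, §1.1 (p. 50)]
[cite: Shimura1998, §8.2 Prop. 26] -/
theorem isNondegenerate_of_isPrimitive_of_tableCensus [IsGalois ℚ K] (mul : X → X → X) (e : (K ≃ₐ[ℚ] K) ≃ X)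
    (hmul : ∀ a b, e (a * b) = mul (e a) (e b)) (c₀ : X)
    (hc : e ((IsCMField.complexConj K).restrictScalars ℚ) = c₀) (o : X) (ho : e 1 = o) {m : ℕ}
    (hm : Fintype.card X = 2 * m) (R : Fin m → X) (hR : ∀ y : X, ∃ i, y = R i ∨ y = mul c₀ (R i)) {r : ℕ}
    (hr : r = m + 1) {q : ℕ} (reps : Fin q → Finset X) (g x : Fin q → Fin r → X)
    (M : Fin q → Fin r → Fin r → ℤ) (D : Fin q → ℤ)
    (hcert : ∀ a : Fin q, D a ≠ 0 ∧ ∀ i k : Fin r,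
      (∑ j : Fin r, if mul (x a j) (g a i) ∈ reps a then M a j k else 0) = if i = k then D a else 0)
    (sel : ℕ → Bool) (stabOf δOf : ℕ → X) (repOf : ℕ → Fin q)
    (hcover : ∀ b : ℕ, b < 2 ^ m →
      (sel b = true ∧ stabOf b ≠ o ∧ ∀ w : X,
        (∃ l : Fin m, (b.testBit l = true ∧ w = R l) ∨ (b.testBit l = false ∧ w = mul c₀ (R l))) ↔
        (∃ l : Fin m, (b.testBit l = true ∧ mul (stabOf b) w = R l) ∨
          (b.testBit l = false ∧ mul (stabOf b) w = mul c₀ (R l)))) ∨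
      (sel b = false ∧ ∀ w : X,
        (∃ l : Fin m, (b.testBit l = true ∧ mul w (δOf b) = R l) ∨
          (b.testBit l = false ∧ mul w (δOf b) = mul c₀ (R l))) ↔ w ∈ reps (repOf b)))
    {Φ : CMType K} (φ₀ : K →+* ℂ) (hprim : IsPrimitive (ℂ ≃+* ℂ) Φ.1 φ₀) : IsNondegenerate Φ := by
  set c : K ≃ₐ[ℚ] K := (IsCMField.complexConj K).restrictScalars ℚ with hc_def
  -- the CM set read on `X`
  set S : Finset X := Finset.univ.filter fun y => embOf φ₀ (e.symm y) ∈ Φ.1 with hS_def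
  have hS : ∀ y : X, y ∈ S ↔ embOf φ₀ (e.symm y) ∈ Φ.1 := fun y => by
    simp only [hS_def, Finset.mem_filter, Finset.mem_univ, true_and]
  have hScm : ∀ y : X, mul c₀ y ∈ S ↔ y ∉ S := fun y => by
    rw [hS, hS, symm_mul mul e hmul, ← hc, Equiv.symm_apply_apply]
    exact Summit.HodgeConjecture.CorCM.GaloisOctic.embOf_complexConj_mul_mem_iff Φ φ₀ _
  -- its sign pattern on the transversal, as a number `b₀ < 2^m`
  obtain ⟨b₀, hb₀, hbit⟩ := GaloisRank.exists_testBit_eq m (fun i => decide (R i ∈ S))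
  have hkey : ∀ w : X, (∃ l : Fin m, (b₀.testBit l = true ∧ w = R l) ∨
      (b₀.testBit l = false ∧ w = mul c₀ (R l))) ↔ w ∈ S := by
    intro w
    simp_rw [hbit]
    constructor
    · rintro ⟨i, (⟨hi, rfl⟩ | ⟨hi, rfl⟩)⟩
      · simpa using hi
      · have hi' : R i ∉ S := by simpa using hi
        exact (hScm (R i)).2 hi'
    · intro hw
      obtain ⟨i, (rfl | rfl)⟩ := hR w
      · exact ⟨i, Or.inl ⟨by simpa using hw, rfl⟩⟩
      · exact ⟨i, Or.inr ⟨by simpa using (hScm (R i)).1 hw, rfl⟩⟩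
  rcases hcover b₀ hb₀ with ⟨-, hv1, hv⟩ | ⟨-, hrep⟩
  · -- a left stabiliser contradicts primitivity
    exfalso
    refine not_isPrimitive_of_tableStabiliser mul e hmul Φ φ₀ S hS (ho ▸ hv1) (fun w => ?_) hprim
    rw [← hkey w, ← hkey (mul (stabOf b₀) w)]
    exact hv w
  · -- `S = rep · δ`: the certificate of `rep`, translated on the right by `δ`
    obtain ⟨hD, hce⟩ := hcert (repOf b₀)
    refine isNondegenerate_of_tableCert mul e hmul Φ φ₀ S hS (r := r)
      (by rw [hr, finrank_eq_card_table e, hm]; omega)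
      (fun i => mul (g (repOf b₀) i) (δOf b₀)) (x (repOf b₀)) (M (repOf b₀)) (D (repOf b₀)) hD fun i k => ?_
    rw [← hce i k]
    refine Finset.sum_congr rfl fun j _ => ?_
    have hiff : mul (x (repOf b₀) j) (mul (g (repOf b₀) i) (δOf b₀)) ∈ S ↔
        mul (x (repOf b₀) j) (g (repOf b₀) i) ∈ reps (repOf b₀) := by
      rw [← hkey, ← mul_assoc_table mul e hmul, hrep]
    by_cases h : mul (x (repOf b₀) j) (g (repOf b₀) i) ∈ reps (repOf b₀)
    · rw [if_pos h, if_pos (hiff.2 h)]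
    · rw [if_neg h, if_neg (fun h' => h (hiff.1 h'))]

/-! ## §4 Null certificates: an upper bound for the rank -/

omit [IsCMField K] in
/-- **Null certificate ⟹ `cmTypeRank Φ + t ≤ [K:ℚ]`.**  If `t` integer vectors `N_{·,k}` on `X` are orthogonal to
every right translate of `S` (`Σ_y [mul y h ∈ S] N_{y k} = 0` for all `h`, `k`) and carry a diagonal minor
(`N_{rows k, k'} = D δ_{k k'}`, `D ≠ 0`), then all `Aut(ℂ)`-translates of `Φ` lie in the kernel of a surjective
linear map onto `ℚ^t`, so `Rank(Φ) ≤ [K:ℚ] − t`. [cite: Dodson1987, §1.1 (p. 50)] [cite: Kubota1965, §2 Lemma 2] -/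
theorem cmTypeRank_add_le_of_tableNull [IsGalois ℚ K] (mul : X → X → X) (e : (K ≃ₐ[ℚ] K) ≃ X)
    (hmul : ∀ a b, e (a * b) = mul (e a) (e b)) (Φ : CMType K) (φ₀ : K →+* ℂ) (S : Finset X)
    (hS : ∀ y : X, y ∈ S ↔ embOf φ₀ (e.symm y) ∈ Φ.1) {t : ℕ} (N : X → Fin t → ℤ)
    (hnull : ∀ (h : X) (k : Fin t), (∑ y : X, if mul y h ∈ S then N y k else 0) = 0) (rows : Fin t → X)
    (D : ℤ) (hD : D ≠ 0) (hrows : ∀ k k' : Fin t, N (rows k) k' = if k = k' then D else 0) :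
    cmTypeRank Φ + t ≤ Module.finrank ℚ K := by
  -- the embeddings indexed by `X`
  set σ : X → (K →+* ℂ) := fun y => embOf φ₀ (e.symm y) with hσ_def
  have hσinj : Function.Injective σ := fun y y' h => e.symm.injective ((embOf_bijective φ₀).1 h)
  -- the linear map `f ↦ (Σ_y f(σ_y) N_{y k})_k`
  let L : ((K →+* ℂ) → ℚ) →ₗ[ℚ] (Fin t → ℚ) :=
    { toFun := fun f k => ∑ y : X, f (σ y) * (N y k : ℚ)
      map_add' := fun f f' => by
        funext k
        simp only [Pi.add_apply, add_mul, Finset.sum_add_distrib]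
      map_smul' := fun a f => by
        funext k
        simp only [Pi.smul_apply, smul_eq_mul, RingHom.id_apply, Finset.mul_sum, mul_assoc] }
  have hL : ∀ f k, L f k = ∑ y : X, f (σ y) * (N y k : ℚ) := fun f k => rfl
  -- every translate is in the kernel
  have hker : ∀ τ : ℂ ≃+* ℂ, translateInd Φ.1 τ ∈ LinearMap.ker L := by
    intro τ
    obtain ⟨γ, hγ⟩ := exists_algEquiv_comp_eq_smul φ₀ τ
    rw [LinearMap.mem_ker]
    funext k
    rw [hL, Pi.zero_apply]
    have h1 : ∀ y : X, translateInd Φ.1 τ (σ y) * (N y k : ℚ) =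
        ((if mul y (e γ⁻¹) ∈ S then N y k else 0 : ℤ) : ℚ) := by
      intro y
      have hsm : τ • σ y = embOf φ₀ (e.symm (mul y (e γ⁻¹))) := by
        rw [hσ_def]
        simp only
        rw [smul_embOf_of_comp φ₀ hγ, symm_mul mul e hmul, Equiv.symm_apply_apply]
      by_cases h : mul y (e γ⁻¹) ∈ S
      · rw [if_pos h, translateInd_of_mem (by rw [hsm]; exact (hS _).1 h)]; simp
      · rw [if_neg h, translateInd_of_not_mem (by rw [hsm]; exact fun h' => h ((hS _).2 h'))]; simp
    simp_rw [h1]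
    rw [← Int.cast_sum, hnull (e γ⁻¹) k, Int.cast_zero]
  -- `L` is surjective
  have hsurj : Function.Surjective L := by
    intro v
    refine ⟨fun z => ∑ k : Fin t, if z = σ (rows k) then v k / D else 0, ?_⟩
    funext k'
    rw [hL]
    have h1 : ∀ y : X, (∑ k : Fin t, if σ y = σ (rows k) then v k / D else 0) * (N y k' : ℚ) =
        ∑ k : Fin t, if y = rows k then v k / D * N (rows k) k' else 0 := by
      intro y
      rw [Finset.sum_mul]
      refine Finset.sum_congr rfl fun k _ => ?_
      by_cases h : y = rows k
      · rw [if_pos (by rw [h]), if_pos h, h]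
      · rw [if_neg (fun h' => h (hσinj h')), if_neg h, zero_mul]
    simp_rw [h1]
    rw [Finset.sum_comm]
    have h2 : ∀ k : Fin t, (∑ y : X, if y = rows k then v k / ↑D * ↑(N (rows k) k') else 0) =
        if k = k' then v k' else 0 := by
      intro k
      rw [Finset.sum_ite_eq' Finset.univ (rows k), if_pos (Finset.mem_univ _), hrows]
      by_cases hk : k = k'
      · rw [if_pos hk, if_pos hk, hk]; exact div_mul_cancel₀ (v k') (Int.cast_ne_zero.2 hD)
      · rw [if_neg hk, if_neg hk, Int.cast_zero, mul_zero]
    simp_rw [h2]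
    rw [Finset.sum_ite_eq' Finset.univ k', if_pos (Finset.mem_univ _)]
  -- rank–nullity
  have hrange : Module.finrank ℚ (LinearMap.range L) = t := by
    rw [LinearMap.range_eq_top.2 hsurj, finrank_top, Module.finrank_fintype_fun_eq_card, Fintype.card_fin]
  have hrn := LinearMap.finrank_range_add_finrank_ker L
  rw [hrange, Module.finrank_fintype_fun_eq_card, NumberField.Embeddings.card K ℂ] at hrn
  have hspan : Submodule.span ℚ (Set.range fun τ : ℂ ≃+* ℂ => translateInd Φ.1 τ) ≤ LinearMap.ker L :=
    Submodule.span_le.2 (by rintro _ ⟨τ, rfl⟩; exact hker τ)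
  have hle := Submodule.finrank_mono hspan
  change Module.finrank ℚ (Submodule.span ℚ (Set.range fun τ : ℂ ≃+* ℂ => translateInd Φ.1 τ)) + t ≤ _
  omega

omit [IsCMField K] in
/-- **Null certificate of size `[K:ℚ]/2` ⟹ DEGENERATE** (`Rank(Φ) ≤ [K:ℚ]/2 < [K:ℚ]/2 + 1`).
[cite: Dodson1987, §1.1 (p. 50)] -/
theorem not_isNondegenerate_of_tableNull [IsGalois ℚ K] (mul : X → X → X) (e : (K ≃ₐ[ℚ] K) ≃ X)
    (hmul : ∀ a b, e (a * b) = mul (e a) (e b)) (Φ : CMType K) (φ₀ : K →+* ℂ) (S : Finset X)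
    (hS : ∀ y : X, y ∈ S ↔ embOf φ₀ (e.symm y) ∈ Φ.1) {m : ℕ} (hm : Fintype.card X = 2 * m)
    (N : X → Fin m → ℤ) (hnull : ∀ (h : X) (k : Fin m), (∑ y : X, if mul y h ∈ S then N y k else 0) = 0)
    (rows : Fin m → X) (D : ℤ) (hD : D ≠ 0) (hrows : ∀ k k' : Fin m, N (rows k) k' = if k = k' then D else 0) :
    ¬ IsNondegenerate Φ := by
  have h := cmTypeRank_add_le_of_tableNull mul e hmul Φ φ₀ S hS N hnull rows D hD hrows
  rw [isNondegenerate_iff, finrank_eq_card_table e, hm]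
  rw [finrank_eq_card_table e, hm] at h
  omega

/-! ## §5 Primitive types from table models; simple degenerate abelian varieties -/

omit [Fintype X] [DecidableEq X] in
/-- **A CM set `T₀ ⊆ X` with trivial left stabiliser is read by a PRIMITIVE CM type** (`K/ℚ` normal CM):
`Φ = {σ_g : e(g) ∈ T₀}`. [cite: Shimura1998, §8.1, §8.2 Prop. 26, §18.2 Lemma (i)] -/
theorem exists_isPrimitive_of_tableModel [Normal ℚ K] (mul : X → X → X) (e : (K ≃ₐ[ℚ] K) ≃ X)
    (hmul : ∀ a b, e (a * b) = mul (e a) (e b)) (c₀ : X) (hc : e ((IsCMField.complexConj K).restrictScalars ℚ) = c₀)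
    (o : X) (ho : e 1 = o) (T₀ : Finset X) (hcm : ∀ a : X, a ∈ T₀ ↔ mul c₀ a ∉ T₀)
    (hprim : ∀ v : X, v ≠ o → ∃ w : X, ¬ (w ∈ T₀ ↔ mul v w ∈ T₀)) (φ₀ : K →+* ℂ) :
    ∃ Φ : CMType K, IsPrimitive (ℂ ≃+* ℂ) Φ.1 φ₀ ∧ ∀ y : X, y ∈ T₀ ↔ embOf φ₀ (e.symm y) ∈ Φ.1 := by
  haveI := isPretransitive_ringEquiv_complex (K := K)
  set c : K ≃ₐ[ℚ] K := (IsCMField.complexConj K).restrictScalars ℚ with hc_def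
  have hEinj : Function.Injective (embOf φ₀) := (embOf_bijective φ₀).1
  have hEsurj : Function.Surjective (embOf φ₀) := (embOf_bijective φ₀).2
  -- the CM type `Φ = σ(e⁻¹ T₀)`
  set S : Set (K →+* ℂ) := {φ | ∃ g : K ≃ₐ[ℚ] K, e g ∈ T₀ ∧ embOf φ₀ g = φ} with hS_def
  have hmemE : ∀ g, embOf φ₀ g ∈ S ↔ e g ∈ T₀ := fun g => by
    constructor
    · rintro ⟨g', hg', hgg'⟩
      rwa [← hEinj hgg']
    · exact fun h => ⟨g, h, rfl⟩
  have hcm' : ∀ φ, φ ∈ S ↔ ComplexEmbedding.conjugate φ ∉ S := by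
    intro φ
    obtain ⟨g, rfl⟩ := hEsurj φ
    rw [← Summit.HodgeConjecture.CorCM.GaloisOctic.embOf_complexConj_mul, hmemE, hmemE, hmul, hc]
    exact hcm (e g)
  let Φ : CMType K := ⟨S, hcm'⟩
  refine ⟨Φ, ?_, fun y => ?_⟩
  · -- primitive: the translates separate the embeddings
    rw [isPrimitive_iff_forall_eq]
    intro φ₁ φ₂ hsep
    obtain ⟨g₁, rfl⟩ := hEsurj φ₁
    obtain ⟨g₂, rfl⟩ := hEsurj φ₂
    by_contra hne
    have hv : e (g₂ * g₁⁻¹) ≠ o := by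
      rw [← ho]
      intro h
      exact hne (by rw [(mul_inv_eq_one.1 (e.injective h))])
    obtain ⟨w, hw⟩ := hprim _ hv
    obtain ⟨τ, hτ⟩ := exists_ringEquiv_comp_eq_algEquiv φ₀ ((e.symm w)⁻¹ * g₁)
    have h := hsep τ
    have h1 : g₁ * ((e.symm w)⁻¹ * g₁)⁻¹ = e.symm w := by rw [mul_inv_rev, inv_inv, mul_inv_cancel_left]
    have h2 : g₂ * ((e.symm w)⁻¹ * g₁)⁻¹ = g₂ * g₁⁻¹ * e.symm w := by rw [mul_inv_rev, inv_inv, mul_assoc]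
    rw [smul_embOf_of_comp φ₀ hτ, smul_embOf_of_comp φ₀ hτ, h1, h2] at h
    change embOf φ₀ (e.symm w) ∈ S ↔ embOf φ₀ (g₂ * g₁⁻¹ * e.symm w) ∈ S at h
    rw [hmemE, hmemE, hmul, Equiv.apply_symm_apply] at h
    exact hw h
  · change y ∈ T₀ ↔ embOf φ₀ (e.symm y) ∈ S
    rw [hmemE, Equiv.apply_symm_apply]

/-- **Table model with a null certificate ⟹ a SIMPLE DEGENERATE CM abelian variety.**  `K/ℚ` Galois CM with a
table model `(X, mul, e)`; `T₀ ⊆ X` a CM set for `c₀ = e(c)` with trivial left stabiliser and a null certificate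
of size `[K:ℚ]/2`.  Then `K` has a PRIMITIVE DEGENERATE CM type, realised (Shimura) by a SIMPLE abelian variety of
dimension `[K:ℚ]/2` carrying an exceptional Hodge class — rational, of type `(p,p)`, outside the complexified
divisor ring — on some power (Hazama/Pohlmann). [cite: Shimura1998, §6.2 Thm. 3 and §8.2 Prop. 26]
[cite: Gordon1999HodgeAVSurvey, Thm. 6.4] [cite: Dodson1987, §1.1 (p. 50)] -/
theorem exists_simple_degenerate_of_tableNull [IsGalois ℚ K] (mul : X → X → X) (e : (K ≃ₐ[ℚ] K) ≃ X)
    (hmul : ∀ a b, e (a * b) = mul (e a) (e b)) (c₀ : X) (hc : e ((IsCMField.complexConj K).restrictScalars ℚ) = c₀)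
    (o : X) (ho : e 1 = o) (T₀ : Finset X) (hcm : ∀ a : X, a ∈ T₀ ↔ mul c₀ a ∉ T₀)
    (hprim : ∀ v : X, v ≠ o → ∃ w : X, ¬ (w ∈ T₀ ↔ mul v w ∈ T₀)) {m : ℕ} (hm : Fintype.card X = 2 * m)
    (N : X → Fin m → ℤ) (hnull : ∀ (h : X) (k : Fin m), (∑ y : X, if mul y h ∈ T₀ then N y k else 0) = 0)
    (rows : Fin m → X) (D : ℤ) (hD : D ≠ 0) (hrows : ∀ k k' : Fin m, N (rows k) k' = if k = k' then D else 0) :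
    ∃ (Φ : CMType K) (φ₀ : K →+* ℂ) (A : AbelianVariety ℂ) (ι : 𝓞 K →+* End A)
      (θ : K →+* Module.End ℂ (complexBetti A.X 1)),
      IsPrimitive (ℂ ≃+* ℂ) Φ.1 φ₀ ∧ ¬ IsNondegenerate Φ ∧ IsCMTypeRealisation Φ A ι θ ∧ A.IsSimple ∧
      A.dim = Module.finrank ℚ K / 2 ∧
      ∃ n p : ℕ, ∃ x : complexBetti (⨁ fun _ : Fin n => A).X (2 * p), IsRationalClass x ∧
        IsOfHodgeType (⨁ fun _ : Fin n => A).dim (⨁ fun _ : Fin n => A).X (2 * p) p p x ∧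
        x ∉ divisorClassesSpan (⨁ fun _ : Fin n => A).X (⨁ fun _ : Fin n => A).dim p := by
  obtain ⟨φ₀⟩ := (inferInstance : Nonempty (K →+* ℂ))
  obtain ⟨Φ, hprimΦ, hread⟩ := exists_isPrimitive_of_tableModel mul e hmul c₀ hc o ho T₀ hcm hprim φ₀
  have hdeg : ¬ IsNondegenerate Φ :=
    not_isNondegenerate_of_tableNull mul e hmul Φ φ₀ T₀ hread hm N hnull rows D hD hrows
  obtain ⟨A, ι, θ, hA, hs, hdim⟩ := exists_simple_realisation_of_isPrimitive Φ φ₀ hprimΦ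
  exact ⟨Φ, φ₀, A, ι, θ, hprimΦ, hdeg, hA, hs, hdim, exists_exceptional_pow_of_not_isNondegenerate φ₀ hprimΦ hdeg hA⟩


end Summit.HodgeConjecture.CorCM.GaloisTable

end
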